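import Literature.Computability.QuantumComplexity.JonesInBQPProofs
import Literature.Computability.QuantumComplexity.PathModelLinkStates
import HarnessLib

/-!
# The AJL unitary in the vertex-sequence (position) encoding

Topic `Literature/Computability/QuantumComplexity`; a step towards the named fact
`ajl_mem_PromiseBQPOver_ajlGateSet` (S2 of the decomposition of `ajl_jonesApproxProblem_mem_PromiseBQP`,
`JonesInBQPProofs.lean`). AJL (arXiv:quant-ph/0511096, §2.12 and §3.1) present a path on `G_k` either
by its sequence of vertices (`𝒱_{n,k}`) or by its sequence of steps (`ℋ_{n,k}`, bit strings), and
"the transition from `τ` to `Φ` is merely a change of language" (Claim 3.1). The gate set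
`ajlGateSet` of `JonesInBQPProofs.lean` uses the vertex-sequence registers at `k = 5` (two qubits
per vertex, `ajlLocalPhi`), while `ajlBraidMatrix` (`PathModelRepresentation.lean`) and the
matrix-element identity `ajl_thm32_matrixElement` use bit strings. This file proves that the change
of language is harmless for the quantity the algorithm estimates:

* `encodePos : QReg n → QReg (2(n+1))`, the vertex-sequence encoding (`z_0 = 1, z_1, …, z_n`,
  two wires per vertex), injective on `P_{n,5}` (`encodePos_injective_of_isGkPath`);
* `placeGate_ajlLocalPhi_encodePos`: between encodings of walks, the local generator placed on the
  registers `i, i+1, i+2` (`tripleEmb`) has exactly the entries of `Φ_i`; and it does not lead out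
  of the encodings of walks (`placeGate_ajlLocalPhi_encodePos_eq_zero`, AJL Claim 3.5);
* the push-forward `pushPos` of functions on step strings and the intertwining relations for
  `Φ_i`, for a crossing and for a whole word (`ajlPosBraidMatrix_mulVec_pushPos`);
* **`ajlPosBraidMatrix_apply_encodePos_ajlAlpha`**:
  `⟨enc α| ∏_letters (1 ⊗ ρ_A(σ^{±1})_{loc} ⊗ 1) |enc α⟩ = ⟨α| φ(b) |α⟩`, so that (with
  `ajl_thm32_matrixElement_holds`) the Hadamard test of the position-encoded circuit of Cor. 3.1
  estimates `ajlRatio 5 n b`.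

## References

* D. Aharonov, V. Jones, Z. Landau, arXiv:quant-ph/0511096, §2.12, §3.1 (Claim 3.1), Claim 3.2,
  Cor. 3.1, Claim 3.5 [AharonovJonesLandau2009].
-/

noncomputable section

open Matrix Complex Finset

namespace Literature.Computability.QuantumComplexity

/-! ### The vertex-sequence (position) encoding of paths at `k = 5` (AJL §2.12 basis `𝒱_{n,k}`) -/

section PositionEncoding

variable {n : ℕ}

/-- High bit of the code of a vertex `z ∈ {1,2,3,4}` (`z - 1` in binary). [cite: AharonovJonesLandau2009, §2.12] -/
def vertexHigh (z : ℤ) : Bool := decide (3 ≤ z)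

/-- Low bit of the code of a vertex `z ∈ {1,2,3,4}`. [cite: AharonovJonesLandau2009, §2.12] -/
def vertexLow (z : ℤ) : Bool := decide (z = 2 ∨ z = 4)

/-- Decoding the code of a vertex of `G_5` gives the vertex back. [folklore] -/
theorem vertexOfBits_high_low {z : ℤ} (hz : 1 ≤ z ∧ z ≤ 4) :
    vertexOfBits (vertexHigh z) (vertexLow z) = z := by
  obtain ⟨h1, h4⟩ := hz
  interval_cases z <;> simp [vertexOfBits, vertexHigh, vertexLow]

/-- The code of a decoded pair of bits is the pair (high bit). [folklore] -/
theorem high_vertexOfBits (a b : Bool) : vertexHigh (vertexOfBits a b) = a := by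
  cases a <;> cases b <;> simp [vertexOfBits, vertexHigh]

/-- The code of a decoded pair of bits is the pair (low bit). [folklore] -/
theorem low_vertexOfBits (a b : Bool) : vertexLow (vertexOfBits a b) = b := by
  cases a <;> cases b <;> simp [vertexOfBits, vertexLow]

/-- The code is injective on the vertices of `G_5`. [folklore] -/
theorem vertex_code_inj {z z' : ℤ} (hz : 1 ≤ z ∧ z ≤ 4) (hz' : 1 ≤ z' ∧ z' ≤ 4)
    (h1 : vertexHigh z = vertexHigh z') (h2 : vertexLow z = vertexLow z') : z = z' := by
  rw [← vertexOfBits_high_low hz, ← vertexOfBits_high_low hz', h1, h2]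

/-- **The position encoding** of a step string `p ∈ {0,1}ⁿ`: `n + 1` two-qubit registers holding
the codes of the vertices `z_0 = 1, z_1, …, z_n` of its walk (register `j` on wires `2j`, `2j+1`,
high bit first). [cite: AharonovJonesLandau2009, §2.12 (paths "presented by their sequence of locations") and Claim 3.1] -/
def encodePos (p : Cryptography.QReg n) : Cryptography.QReg (2 * (n + 1)) := fun w =>
  if (w : ℕ) % 2 = 0 then vertexHigh (pathPos p ((w : ℕ) / 2)) else vertexLow (pathPos p ((w : ℕ) / 2))

/-- The high wire of register `j`. [folklore] -/
theorem encodePos_apply_even (p : Cryptography.QReg n) (j : ℕ) (hj : 2 * j < 2 * (n + 1)) :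
    encodePos p ⟨2 * j, hj⟩ = vertexHigh (pathPos p j) := by
  simp only [encodePos, Nat.mul_mod_right, if_true]
  congr 2; omega

/-- The low wire of register `j`. [folklore] -/
theorem encodePos_apply_odd (p : Cryptography.QReg n) (j : ℕ) (hj : 2 * j + 1 < 2 * (n + 1)) :
    encodePos p ⟨2 * j + 1, hj⟩ = vertexLow (pathPos p j) := by
  simp only [encodePos]
  rw [if_neg (by omega)]
  congr 2; omega

/-- The six wires of the registers `i`, `i+1`, `i+2` acted on by generator `i`. [cite: AharonovJonesLandau2009, Claim 3.2] -/
def tripleEmb (i : Fin (n - 1)) : Fin 6 ↪ Fin (2 * (n + 1)) :=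
  ⟨fun t => ⟨2 * (i : ℕ) + (t : ℕ), by have := i.2; have := t.2; omega⟩,
    fun t t' h => Fin.ext (by have := Fin.ext_iff.1 h; simp at this; omega)⟩

/-- Values of the embedded wires. [folklore] -/
@[simp] theorem tripleEmb_val (i : Fin (n - 1)) (t : Fin 6) :
    ((tripleEmb i t : Fin (2 * (n + 1))) : ℕ) = 2 * (i : ℕ) + t := rfl

end PositionEncoding

section PositionEntries

variable {n : ℕ} {i : Fin (n - 1)}

/-- Positions of a walk of `P_{n,5}` are vertices of `G_5 = {1,2,3,4}`. [cite: AharonovJonesLandau2009, Def. 3.1] -/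
theorem IsGkPath.pos_mem {p : Cryptography.QReg n} (hp : IsGkPath 5 n p) {j : ℕ} (hj : j ≤ n) :
    1 ≤ pathPos p j ∧ pathPos p j ≤ 4 := by
  have := hp j hj; omega

/-- Equal consecutive positions force equal bits. [folklore] -/
theorem bit_eq_of_pathPos_eq {p q : Cryptography.QReg n} {t : ℕ} (ht : t < n) (h0 : pathPos p t = pathPos q t)
    (h1 : pathPos p (t + 1) = pathPos q (t + 1)) : p ⟨t, ht⟩ = q ⟨t, ht⟩ := by
  rw [pathPos_succ p ht, pathPos_succ q ht, h0] at h1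
  have : stepSign (p ⟨t, ht⟩) = stepSign (q ⟨t, ht⟩) := by linarith
  cases hp : p ⟨t, ht⟩ <;> cases hq : q ⟨t, ht⟩ <;> simp_all [stepSign]

/-- On the support of `Φ_i`, the positions of the two strings agree everywhere except at `i + 1`.
[cite: AharonovJonesLandau2009, §3.1] -/
theorem PhiSupport.pathPos_eq_of_ne {q p : Cryptography.QReg n} (h : PhiSupport 5 n i q p) {j : ℕ} (hj : j ≠ (i : ℕ) + 1) :
    pathPos q j = pathPos p j := by
  have e := eq_flipTo_of_agree h.2.2.1 h.2.2.2.2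
  rw [e]
  exact pathPos_flipTo_of_ne p i _ h.snd_eq hj

/-- **The entries of the placed local generator between position encodings are those of `Φ_i`.**
For walks `p, q ∈ P_{n,5}`,
`(1 ⊗ Φ_loc ⊗ 1)_{enc q, enc p} = (Φ_i)_{q, p}` — AJL's "natural isomorphism between `𝒱_{n,k}` and
`ℋ_{n,k}`" (Claim 3.1) in matrix form. [cite: AharonovJonesLandau2009, Claim 3.1 and §2.12] -/
theorem placeGate_ajlLocalPhi_encodePos {p q : Cryptography.QReg n} (hp : IsGkPath 5 n p) (hq : IsGkPath 5 n q) :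
    Cryptography.placeGate (tripleEmb i) ajlLocalPhi (encodePos q) (encodePos p) = ajlPhi 5 n i q p := by
  have hi : (i : ℕ) + 1 < n := by have := i.2; omega
  -- the six wires, decoded
  have codes : ∀ (r : Cryptography.QReg n), IsGkPath 5 n r → ∀ j, j ≤ n →
      vertexOfBits (vertexHigh (pathPos r j)) (vertexLow (pathPos r j)) = pathPos r j :=
    fun r hr j hj => vertexOfBits_high_low (hr.pos_mem hj)
  have w0 : ∀ r : Cryptography.QReg n, (encodePos r ∘ tripleEmb i) 0 = vertexHigh (pathPos r i) := fun r => by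
    show encodePos r ⟨2 * (i : ℕ) + 0, _⟩ = _; simp only [add_zero]; exact encodePos_apply_even r i _
  have w1 : ∀ r : Cryptography.QReg n, (encodePos r ∘ tripleEmb i) 1 = vertexLow (pathPos r i) := fun r =>
    encodePos_apply_odd r i _
  have w2 : ∀ r : Cryptography.QReg n, (encodePos r ∘ tripleEmb i) 2 = vertexHigh (pathPos r (i + 1)) := fun r => by
    show encodePos r ⟨2 * ((i : ℕ) + 1), _⟩ = _; exact encodePos_apply_even r _ _
  have w3 : ∀ r : Cryptography.QReg n, (encodePos r ∘ tripleEmb i) 3 = vertexLow (pathPos r (i + 1)) := fun r => by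
    show encodePos r ⟨2 * ((i : ℕ) + 1) + 1, _⟩ = _; exact encodePos_apply_odd r _ _
  have w4 : ∀ r : Cryptography.QReg n, (encodePos r ∘ tripleEmb i) 4 = vertexHigh (pathPos r (i + 2)) := fun r => by
    show encodePos r ⟨2 * ((i : ℕ) + 2), _⟩ = _; exact encodePos_apply_even r _ _
  have w5 : ∀ r : Cryptography.QReg n, (encodePos r ∘ tripleEmb i) 5 = vertexLow (pathPos r (i + 2)) := fun r => by
    show encodePos r ⟨2 * ((i : ℕ) + 2) + 1, _⟩ = _; exact encodePos_apply_odd r _ _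
  rw [Cryptography.placeGate_apply]
  by_cases hs : PhiSupport 5 n i q p
  · -- on the support: the wires off the three registers agree, and the local support holds
    have hpos : ∀ j : ℕ, j ≠ (i : ℕ) + 1 → pathPos q j = pathPos p j := fun j hj => hs.pathPos_eq_of_ne hj
    have hoff : ∀ w : Fin (2 * (n + 1)), w ∉ Set.range (tripleEmb i) → encodePos q w = encodePos p w := by
      intro w hw
      have hw' : (w : ℕ) / 2 ≠ (i : ℕ) + 1 := by
        intro e
        apply hw
        refine ⟨⟨(w : ℕ) - 2 * (i : ℕ), by omega⟩, Fin.ext ?_⟩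
        simp; omega
      simp only [encodePos, hpos _ hw']
    rw [if_pos hoff, ajlLocalPhi_apply]
    simp only [w0, w1, w2, w3, codes p hp (i : ℕ) (by omega),
      codes q hq ((i : ℕ) + 1) (by omega), codes p hp ((i : ℕ) + 1) (by omega)]
    have hz0 : pathPos q i = pathPos p i := hpos _ (by omega)
    have hz2 : pathPos q ((i : ℕ) + 2) = pathPos p ((i : ℕ) + 2) := hpos _ (by omega)
    have hpp : pathPos p ((i : ℕ) + 2) = pathPos p i := pathPos_add_two hs.snd_eq
    have hp1 : pathPos p ((i : ℕ) + 1) = pathPos p i + stepSign (p (genFst i)) := pathPos_succ p (by omega)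
    have hq1 : pathPos q ((i : ℕ) + 1) = pathPos p i + stepSign (q (genFst i)) := by
      rw [pathPos_succ q (by omega : (i : ℕ) < n), hz0]; rfl
    have hls : LocalSupport (encodePos q ∘ tripleEmb i) (encodePos p ∘ tripleEmb i) := by
      refine ⟨?_, ?_, ?_, ?_, ?_⟩
      · rw [w0, w1, w0, w1, codes p hp (i : ℕ) (by omega), codes q hq (i : ℕ) (by omega), hz0]
      · rw [w4, w5, w4, w5, codes p hp ((i : ℕ) + 2) (by omega), codes q hq ((i : ℕ) + 2) (by omega), hz2]
      · rw [w0, w1, w4, w5, codes p hp (i : ℕ) (by omega), codes p hp ((i : ℕ) + 2) (by omega), hpp]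
      · rw [w2, w3, w0, w1, codes p hp ((i : ℕ) + 1) (by omega), codes p hp (i : ℕ) (by omega), hp1]
        cases p (genFst i) <;> simp [stepSign]; omega
      · rw [w2, w3, w0, w1, codes q hq ((i : ℕ) + 1) (by omega), codes p hp (i : ℕ) (by omega), hq1]
        cases q (genFst i) <;> simp [stepSign]; omega
    rw [if_pos hls, ajlPhi_apply, if_pos hs, hp1, hq1]
  · -- off the support: both vanish
    rw [ajlPhi_apply, if_neg hs]
    split_ifs with hoff
    · rw [ajlLocalPhi_apply, if_neg]
      intro hls
      apply hs
      obtain ⟨a1, a2, a3, a4, a5⟩ := hls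
      simp only [w0, w1, w4, w5, codes q hq (i : ℕ) (by omega), codes p hp (i : ℕ) (by omega),
        codes q hq ((i : ℕ) + 2) (by omega), codes p hp ((i : ℕ) + 2) (by omega)] at a1 a2 a3
      -- positions agree off `i+1`
      have hpos : ∀ j : ℕ, j ≤ n → j ≠ (i : ℕ) + 1 → pathPos q j = pathPos p j := by
        intro j hj hj1
        by_cases h0 : j = i
        · rw [h0]; exact a1.symm
        by_cases h2 : j = (i : ℕ) + 2
        · rw [h2]; exact a2.symm
        have hw : (⟨2 * j, by omega⟩ : Fin (2 * (n + 1))) ∉ Set.range (tripleEmb i) := by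
          rintro ⟨t, ht⟩; have := Fin.ext_iff.1 ht; simp at this; omega
        have hw' : (⟨2 * j + 1, by omega⟩ : Fin (2 * (n + 1))) ∉ Set.range (tripleEmb i) := by
          rintro ⟨t, ht⟩; have := Fin.ext_iff.1 ht; simp at this; omega
        have e1 := hoff _ hw
        have e2 := hoff _ hw'
        rw [encodePos_apply_even, encodePos_apply_even] at e1
        rw [encodePos_apply_odd, encodePos_apply_odd] at e2
        exact vertex_code_inj (hq.pos_mem hj) (hp.pos_mem hj) e1 e2
      refine ⟨hp, hq, fun t h1 h2 => ?_, ?_, ?_⟩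
      · have ht1 : (t : ℕ) ≠ i := fun e => h1 (Fin.ext e)
        have ht2 : (t : ℕ) ≠ (i : ℕ) + 1 := fun e => h2 (Fin.ext e)
        rw [← Fin.eta t t.2]
        exact bit_eq_of_pathPos_eq t.2 (hpos t (by omega) ht2) (hpos (t + 1) (by omega) (by omega))
      · -- `p_i ≠ p_{i+1}` from `z_{i+2} = z_i`
        intro e
        have h1 := pathPos_succ p (show (i : ℕ) < n by omega)
        have h2 := pathPos_succ p hi
        rw [show (⟨(i : ℕ), _⟩ : Fin n) = genFst i from rfl] at h1
        rw [show (⟨(i : ℕ) + 1, hi⟩ : Fin n) = genSnd i from rfl, ← e, h1] at h2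
        have key : pathPos p ((i : ℕ) + 1 + 1) = pathPos p i := by
          rw [show (i : ℕ) + 1 + 1 = (i : ℕ) + 2 by ring]; exact a3.symm
        rw [h2] at key
        cases hb : p (genFst i) <;> simp [hb, stepSign] at key <;> omega
      · intro e
        have h1 := pathPos_succ q (show (i : ℕ) < n by omega)
        have h2 := pathPos_succ q hi
        rw [show (⟨(i : ℕ), _⟩ : Fin n) = genFst i from rfl] at h1
        rw [show (⟨(i : ℕ) + 1, hi⟩ : Fin n) = genSnd i from rfl, ← e, h1] at h2
        have key : pathPos q ((i : ℕ) + 1 + 1) = pathPos q i := by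
          rw [show (i : ℕ) + 1 + 1 = (i : ℕ) + 2 by ring, ← a2, ← a3, a1]
        rw [h2] at key
        cases hb : q (genFst i) <;> simp [hb, stepSign] at key <;> omega
    · rfl

end PositionEntries

section PositionTransport

variable {n : ℕ} {i : Fin (n - 1)}

/-- The position encoding is injective on `P_{n,5}`. [folklore] -/
theorem encodePos_injective_of_isGkPath {p q : Cryptography.QReg n} (hp : IsGkPath 5 n p) (hq : IsGkPath 5 n q)
    (h : encodePos p = encodePos q) : p = q := by
  have hpos : ∀ j, j ≤ n → pathPos p j = pathPos q j := by
    intro j hj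
    have e1 := congr_fun h ⟨2 * j, by omega⟩
    have e2 := congr_fun h ⟨2 * j + 1, by omega⟩
    rw [encodePos_apply_even, encodePos_apply_even] at e1
    rw [encodePos_apply_odd, encodePos_apply_odd] at e2
    exact vertex_code_inj (hp.pos_mem hj) (hq.pos_mem hj) e1 e2
  funext t
  rw [← Fin.eta t t.2]
  exact bit_eq_of_pathPos_eq t.2 (hpos t (by omega)) (hpos (t + 1) (by omega))

/-- **Rows that are not encodings of walks vanish**: from the encoding of a walk `p ∈ P_{n,5}`, the
placed local generator only leads to encodings of walks of `P_{n,5}`. [cite: AharonovJonesLandau2009, Claim 3.5 (`Φ_i` maps paths to paths)] -/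
theorem placeGate_ajlLocalPhi_encodePos_eq_zero {p : Cryptography.QReg n} (hp : IsGkPath 5 n p) {y : Cryptography.QReg (2 * (n + 1))}
    (hy : ∀ q : Cryptography.QReg n, IsGkPath 5 n q → encodePos q ≠ y) :
    Cryptography.placeGate (tripleEmb i) ajlLocalPhi y (encodePos p) = 0 := by
  have hi : (i : ℕ) + 1 < n := by have := i.2; omega
  rw [Cryptography.placeGate_apply]
  split_ifs with hoff
  swap
  · rfl
  rw [ajlLocalPhi_apply]
  split_ifs with hls
  swap
  · rfl
  exfalso
  -- decode the local support
  have codes : ∀ j, j ≤ n → vertexOfBits (vertexHigh (pathPos p j)) (vertexLow (pathPos p j)) = pathPos p j :=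
    fun j hj => vertexOfBits_high_low (hp.pos_mem hj)
  have w0 : (encodePos p ∘ tripleEmb i) 0 = vertexHigh (pathPos p i) := by
    show encodePos p ⟨2 * (i : ℕ) + 0, _⟩ = _; simp only [add_zero]; exact encodePos_apply_even p i _
  have w1 : (encodePos p ∘ tripleEmb i) 1 = vertexLow (pathPos p i) := encodePos_apply_odd p i _
  have w4 : (encodePos p ∘ tripleEmb i) 4 = vertexHigh (pathPos p (i + 2)) := by
    show encodePos p ⟨2 * ((i : ℕ) + 2), _⟩ = _; exact encodePos_apply_even p _ _
  have w5 : (encodePos p ∘ tripleEmb i) 5 = vertexLow (pathPos p (i + 2)) := by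
    show encodePos p ⟨2 * ((i : ℕ) + 2) + 1, _⟩ = _; exact encodePos_apply_odd p _ _
  obtain ⟨a1, a2, a3, a4, a5⟩ := hls
  rw [w0, w1, codes _ (by omega)] at a1 a3 a5
  rw [w4, w5, codes _ (by omega)] at a2 a3
  -- `p` reads `01`/`10` at `i, i+1` (its walk returns: `z_{i+2} = z_i`)
  have hsnd : p (genSnd i) = !p (genFst i) := by
    have h1 := pathPos_succ p (show (i : ℕ) < n by omega)
    have h2 := pathPos_succ p hi
    rw [show (⟨(i : ℕ), _⟩ : Fin n) = genFst i from rfl] at h1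
    rw [show (⟨(i : ℕ) + 1, hi⟩ : Fin n) = genSnd i from rfl, h1] at h2
    have key : pathPos p ((i : ℕ) + 1 + 1) = pathPos p i := by
      rw [show (i : ℕ) + 1 + 1 = (i : ℕ) + 2 by ring]; exact a3.symm
    rw [h2] at key
    cases hb : p (genFst i) <;> cases hb' : p (genSnd i) <;> simp [hb, hb', stepSign] at key ⊢ <;> omega
  -- the new middle vertex and the flip realising it
  set v : ℤ := vertexOfBits ((y ∘ tripleEmb i) 2) ((y ∘ tripleEmb i) 3) with hv
  have hvmem : 1 ≤ v ∧ v ≤ 4 := vertexOfBits_mem _ _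
  set b : Bool := decide (v = pathPos p i + 1) with hb
  have hvb : pathPos p i + stepSign b = v := by
    rcases a5 with h | h
    · have : b = true := by rw [hb]; simp [h]
      rw [this]; simp [stepSign]; exact h.symm
    · have : b = false := by rw [hb]; simp [h]; omega
      rw [this]; simp [stepSign]; omega
  have hqv : IsGkPath 5 n (flipTo p i b) :=
    isGkPath_flipTo hp hsnd b (by rw [hvb]; omega)
  apply hy (flipTo p i b) hqv
  -- `y = encodePos (flipTo p i b)`
  funext w
  have hposq : ∀ j : ℕ, j ≠ (i : ℕ) + 1 → pathPos (flipTo p i b) j = pathPos p j :=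
    fun j hj => pathPos_flipTo_of_ne p i b hsnd hj
  have hq1 : pathPos (flipTo p i b) ((i : ℕ) + 1) = v := by
    rw [pathPos_succ _ (show (i : ℕ) < n by omega), show (⟨(i : ℕ), _⟩ : Fin n) = genFst i from rfl,
      flipTo_genFst, pathPos_flipTo_of_le p i b le_rfl, hvb]
  by_cases hw : w ∈ Set.range (tripleEmb i)
  · obtain ⟨t, rfl⟩ := hw
    -- the six local wires: registers `i`, `i+1`, `i+2`
    have y01 : (y ∘ tripleEmb i) 0 = vertexHigh (pathPos p i) ∧ (y ∘ tripleEmb i) 1 = vertexLow (pathPos p i) := by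
      constructor
      · rw [← high_vertexOfBits ((y ∘ tripleEmb i) 0) ((y ∘ tripleEmb i) 1), ← a1]
      · rw [← low_vertexOfBits ((y ∘ tripleEmb i) 0) ((y ∘ tripleEmb i) 1), ← a1]
    have y45 : (y ∘ tripleEmb i) 4 = vertexHigh (pathPos p ((i : ℕ) + 2)) ∧
        (y ∘ tripleEmb i) 5 = vertexLow (pathPos p ((i : ℕ) + 2)) := by
      constructor
      · rw [← high_vertexOfBits ((y ∘ tripleEmb i) 4) ((y ∘ tripleEmb i) 5), ← a2]
      · rw [← low_vertexOfBits ((y ∘ tripleEmb i) 4) ((y ∘ tripleEmb i) 5), ← a2]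
    have y23 : (y ∘ tripleEmb i) 2 = vertexHigh v ∧ (y ∘ tripleEmb i) 3 = vertexLow v := by
      constructor
      · rw [hv, high_vertexOfBits]
      · rw [hv, low_vertexOfBits]
    fin_cases t
    · show encodePos (flipTo p i b) ⟨2 * (i : ℕ) + 0, _⟩ = (y ∘ tripleEmb i) 0
      rw [y01.1]; simp only [add_zero]; rw [encodePos_apply_even, hposq _ (by omega)]
    · show encodePos (flipTo p i b) ⟨2 * (i : ℕ) + 1, _⟩ = (y ∘ tripleEmb i) 1
      rw [y01.2, encodePos_apply_odd, hposq _ (by omega)]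
    · show encodePos (flipTo p i b) ⟨2 * ((i : ℕ) + 1), _⟩ = (y ∘ tripleEmb i) 2
      rw [y23.1, encodePos_apply_even, hq1]
    · show encodePos (flipTo p i b) ⟨2 * ((i : ℕ) + 1) + 1, _⟩ = (y ∘ tripleEmb i) 3
      rw [y23.2, encodePos_apply_odd, hq1]
    · show encodePos (flipTo p i b) ⟨2 * ((i : ℕ) + 2), _⟩ = (y ∘ tripleEmb i) 4
      rw [y45.1, encodePos_apply_even, hposq _ (by omega)]
    · show encodePos (flipTo p i b) ⟨2 * ((i : ℕ) + 2) + 1, _⟩ = (y ∘ tripleEmb i) 5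
      rw [y45.2, encodePos_apply_odd, hposq _ (by omega)]
  · -- off the six wires: `y` agrees with the encoding of `p`, whose positions are those of the flip
    rw [hoff w hw]
    have hw' : (w : ℕ) / 2 ≠ (i : ℕ) + 1 := by
      intro e; apply hw
      exact ⟨⟨(w : ℕ) - 2 * (i : ℕ), by omega⟩, Fin.ext (by simp; omega)⟩
    simp only [encodePos, hposq _ hw']

end PositionTransport

section PositionPush

variable {n : ℕ}

/-- **Push-forward to the position registers**: a function on step strings becomes a function on
position registers supported on the encodings of the walks of `P_{n,5}`. [cite: AharonovJonesLandau2009, Claim 3.1 (the natural isomorphism `𝒱_{n,k} ≅ ℋ_{n,k}`)] -/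
def pushPos (v : Cryptography.QReg n → ℂ) : Cryptography.QReg (2 * (n + 1)) → ℂ := fun y =>
  ∑ p, if IsGkPath 5 n p ∧ encodePos p = y then v p else 0

/-- The push-forward at the encoding of a walk. [folklore] -/
theorem pushPos_encodePos (v : Cryptography.QReg n → ℂ) {q : Cryptography.QReg n} (hq : IsGkPath 5 n q) :
    pushPos v (encodePos q) = v q := by
  rw [pushPos, Finset.sum_eq_single q]
  · simp [hq]
  · intro p _ hp
    rw [if_neg]
    rintro ⟨hp', e⟩
    exact hp (encodePos_injective_of_isGkPath hp' hq e)
  · simp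

/-- The push-forward vanishes off the encodings of walks. [folklore] -/
theorem pushPos_of_not (v : Cryptography.QReg n → ℂ) {y : Cryptography.QReg (2 * (n + 1))}
    (hy : ∀ q : Cryptography.QReg n, IsGkPath 5 n q → encodePos q ≠ y) : pushPos v y = 0 := by
  rw [pushPos]
  refine Finset.sum_eq_zero fun p _ => ?_
  rw [if_neg]
  rintro ⟨hp, e⟩
  exact hy p hp e

/-- The push-forward is additive. [folklore] -/
theorem pushPos_add (v v' : Cryptography.QReg n → ℂ) : pushPos (v + v') = pushPos v + pushPos v' := by
  funext y
  simp only [pushPos, Pi.add_apply, ← Finset.sum_add_distrib]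
  refine Finset.sum_congr rfl fun p _ => ?_
  split_ifs <;> simp

/-- The push-forward is homogeneous. [folklore] -/
theorem pushPos_smul (c : ℂ) (v : Cryptography.QReg n → ℂ) : pushPos (c • v) = c • pushPos v := by
  funext y
  simp only [pushPos, Pi.smul_apply, smul_eq_mul, Finset.mul_sum]
  refine Finset.sum_congr rfl fun p _ => ?_
  split_ifs <;> simp

/-- Placing a real gate and mapping to `ℂ` commute. [folklore] -/
theorem placeGate_map_ofReal {k N : ℕ} (e : Fin k ↪ Fin N) (M : Matrix (Cryptography.QReg k) (Cryptography.QReg k) ℝ) (x y : Cryptography.QReg N) :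
    Cryptography.placeGate e (M.map ((↑) : ℝ → ℂ)) x y = ((Cryptography.placeGate e M x y : ℝ) : ℂ) := by
  rw [Cryptography.placeGate_apply, Cryptography.placeGate_apply]
  split_ifs <;> simp

/-- `placeGate` is additive in the gate. [folklore] -/
theorem placeGate_add' {k N : ℕ} (e : Fin k ↪ Fin N) (M M' : Matrix (Cryptography.QReg k) (Cryptography.QReg k) ℂ) :
    Cryptography.placeGate e (M + M') = Cryptography.placeGate e M + Cryptography.placeGate e M' := by
  ext x y
  simp only [Cryptography.placeGate_apply, Matrix.add_apply]
  split_ifs <;> simp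

/-- `placeGate` is homogeneous in the gate. [folklore] -/
theorem placeGate_smul' {k N : ℕ} (e : Fin k ↪ Fin N) (c : ℂ) (M : Matrix (Cryptography.QReg k) (Cryptography.QReg k) ℂ) :
    Cryptography.placeGate e (c • M) = c • Cryptography.placeGate e M := by
  ext x y
  simp only [Cryptography.placeGate_apply, Matrix.smul_apply, smul_eq_mul]
  split_ifs <;> simp

/-- A function on step strings supported on the walks of `P_{n,5}`. [folklore] -/
def OnWalks (v : Cryptography.QReg n → ℂ) : Prop := ∀ p, ¬ IsGkPath 5 n p → v p = 0

/-- `Φ_i` (over `ℂ`) preserves support on walks (its rows at non-walks vanish). [cite: AharonovJonesLandau2009, Claim 3.5] -/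
theorem onWalks_ajlPhiC_mulVec (i : Fin (n - 1)) (v : Cryptography.QReg n → ℂ) : OnWalks ((ajlPhiC 5 n i).mulVec v) := by
  intro p hp
  rw [Matrix.mulVec, dotProduct]
  refine Finset.sum_eq_zero fun r _ => ?_
  have : ajlPhi 5 n i p r = 0 := by rw [ajlPhi_apply, if_neg]; exact fun h => hp h.2.1
  simp [ajlPhiC, Matrix.map_apply, this]

/-- **Intertwining for `Φ_i`**: on the position registers, the placed local generator acts on
push-forwards as `Φ_i` does on step strings. [cite: AharonovJonesLandau2009, Claim 3.1] -/
theorem placeGate_ajlLocalPhi_mulVec_pushPos (i : Fin (n - 1)) (v : Cryptography.QReg n → ℂ) (hv : OnWalks v) :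
    (Cryptography.placeGate (tripleEmb i) (ajlLocalPhi.map ((↑) : ℝ → ℂ))).mulVec (pushPos v) =
      pushPos ((ajlPhiC 5 n i).mulVec v) := by
  funext y
  -- the left side, with the sum over registers collapsed to a sum over walks
  have hL : (Cryptography.placeGate (tripleEmb i) (ajlLocalPhi.map ((↑) : ℝ → ℂ))).mulVec (pushPos v) y =
      ∑ p, if IsGkPath 5 n p then Cryptography.placeGate (tripleEmb i) (ajlLocalPhi.map ((↑) : ℝ → ℂ)) y (encodePos p) * v p
        else 0 := by
    rw [Matrix.mulVec, dotProduct]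
    simp only [pushPos, Finset.mul_sum]
    rw [Finset.sum_comm]
    refine Finset.sum_congr rfl fun p _ => ?_
    by_cases hp : IsGkPath 5 n p
    · rw [if_pos hp, Finset.sum_eq_single (encodePos p)]
      · simp [hp]
      · intro x _ hx; rw [if_neg (fun h => hx h.2.symm), mul_zero]
      · simp
    · rw [if_neg hp]
      exact Finset.sum_eq_zero fun x _ => by rw [if_neg (fun h => hp h.1), mul_zero]
  rw [hL]
  by_cases hy : ∃ q, IsGkPath 5 n q ∧ encodePos q = y
  · obtain ⟨q, hq, rfl⟩ := hy
    rw [pushPos_encodePos _ hq, Matrix.mulVec, dotProduct]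
    refine Finset.sum_congr rfl fun p _ => ?_
    by_cases hp : IsGkPath 5 n p
    · rw [if_pos hp, placeGate_map_ofReal, placeGate_ajlLocalPhi_encodePos hp hq]; rfl
    · rw [if_neg hp, hv p hp, mul_zero]
  · simp only [not_exists, not_and] at hy
    rw [pushPos_of_not _ (fun q hq => hy q hq)]
    refine Finset.sum_eq_zero fun p _ => ?_
    split_ifs with hp
    · rw [placeGate_map_ofReal, placeGate_ajlLocalPhi_encodePos_eq_zero hp (fun q hq => hy q hq)]
      simp
    · rfl

/-- **Intertwining for a crossing.** [cite: AharonovJonesLandau2009, Claim 3.2 and Cor. 3.1] -/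
theorem placeGate_ajlLocalCrossing_mulVec_pushPos (g : Fin (n - 1) × Bool) (v : Cryptography.QReg n → ℂ) (hv : OnWalks v) :
    (Cryptography.placeGate (tripleEmb g.1) (ajlLocalCrossing g.2)).mulVec (pushPos v) =
      pushPos ((ajlCrossingMatrix 5 g).mulVec v) := by
  rw [ajlLocalCrossing, placeGate_add', placeGate_smul', placeGate_smul', Cryptography.placeGate_one, Matrix.add_mulVec,
    Matrix.smul_mulVec, Matrix.smul_mulVec, Matrix.one_mulVec,
    placeGate_ajlLocalPhi_mulVec_pushPos g.1 v hv, ajlCrossingMatrix, Matrix.add_mulVec,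
    Matrix.smul_mulVec, Matrix.smul_mulVec, Matrix.one_mulVec, pushPos_add, pushPos_smul, pushPos_smul]

/-- Crossings preserve support on walks. [cite: AharonovJonesLandau2009, Claim 3.5] -/
theorem onWalks_ajlCrossingMatrix_mulVec (g : Fin (n - 1) × Bool) (v : Cryptography.QReg n → ℂ) (hv : OnWalks v) :
    OnWalks ((ajlCrossingMatrix 5 g).mulVec v) := by
  intro p hp
  rw [ajlCrossingMatrix, Matrix.add_mulVec, Matrix.smul_mulVec, Matrix.smul_mulVec, Matrix.one_mulVec,
    Pi.add_apply, Pi.smul_apply, Pi.smul_apply, onWalks_ajlPhiC_mulVec g.1 v p hp, hv p hp]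
  simp

/-- **The braid-word unitary in the position encoding**: each letter `σ_i^{±1}` is the local
crossing gate placed on the registers `i`, `i+1`, `i+2` (ordered product, letter `0` leftmost).
[cite: AharonovJonesLandau2009, Cor. 3.1] -/
def ajlPosBraidMatrix {n : ℕ} (b : BraidWord n) : Matrix (Cryptography.QReg (2 * (n + 1))) (Cryptography.QReg (2 * (n + 1))) ℂ :=
  (b.map fun g => Cryptography.placeGate (tripleEmb g.1) (ajlLocalCrossing g.2)).prod

/-- Intertwining for a whole word. [cite: AharonovJonesLandau2009, Cor. 3.1] -/
theorem ajlPosBraidMatrix_mulVec_pushPos (b : BraidWord n) (v : Cryptography.QReg n → ℂ) (hv : OnWalks v) :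
    (ajlPosBraidMatrix b).mulVec (pushPos v) = pushPos ((ajlBraidMatrix 5 b).mulVec v) := by
  induction b generalizing v with
  | nil => simp [ajlPosBraidMatrix, ajlBraidMatrix_eq]
  | cons g b ih =>
    have hw : OnWalks ((ajlBraidMatrix 5 b).mulVec v) := by
      clear ih
      induction b generalizing v with
      | nil => simpa [ajlBraidMatrix_eq] using hv
      | cons g' b' ih' =>
        rw [ajlBraidMatrix_eq, List.map_cons, List.prod_cons, ← Matrix.mulVec_mulVec, ← ajlBraidMatrix_eq]
        exact onWalks_ajlCrossingMatrix_mulVec g' _ (ih' v hv)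
    rw [ajlPosBraidMatrix, List.map_cons, List.prod_cons, ← Matrix.mulVec_mulVec, ← ajlPosBraidMatrix, ih v hv,
      placeGate_ajlLocalCrossing_mulVec_pushPos g _ hw, Matrix.mulVec_mulVec, ajlBraidMatrix_eq, ajlBraidMatrix_eq,
      List.map_cons, List.prod_cons]

/-- **The matrix element is the same in both encodings**: `⟨enc α| U^{pos}_b |enc α⟩ = ⟨α| φ(b) |α⟩`
(so the Hadamard test of the position-encoded circuit estimates `ajlRatio 5 n b`). [cite: AharonovJonesLandau2009, Claim 3.1 and Thm. 3.2] -/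
theorem ajlPosBraidMatrix_apply_encodePos_ajlAlpha (b : BraidWord n) :
    ajlPosBraidMatrix b (encodePos (ajlAlpha n)) (encodePos (ajlAlpha n)) = ajlBraidMatrix 5 b (ajlAlpha n) (ajlAlpha n) := by
  have hα : IsGkPath 5 n (ajlAlpha n) := isGkPath_ajlAlpha (by norm_num) n
  have hsingle : pushPos (Pi.single (ajlAlpha n) (1 : ℂ)) = Pi.single (encodePos (ajlAlpha n)) 1 := by
    funext y
    rw [pushPos, Finset.sum_eq_single (ajlAlpha n), Pi.single_eq_same, Pi.single_apply]
    · by_cases h : encodePos (ajlAlpha n) = y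
      · rw [if_pos ⟨hα, h⟩, if_pos h.symm]
      · rw [if_neg (fun h' => h h'.2), if_neg (fun h' => h h'.symm)]
    · intro p _ hp; rw [Pi.single_apply, if_neg hp]; split_ifs <;> rfl
    · simp
  have hwalks : OnWalks (Pi.single (ajlAlpha n) (1 : ℂ)) := by
    intro p hp; rw [Pi.single_apply, if_neg]; rintro rfl; exact hp hα
  rw [← Matrix.col_apply (ajlPosBraidMatrix b), ← Matrix.mulVec_single_one, ← hsingle,
    ajlPosBraidMatrix_mulVec_pushPos b _ hwalks, pushPos_encodePos _ hα, Matrix.mulVec_single_one, Matrix.col_apply]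

end PositionPush

end Literature.Computability.QuantumComplexity

end
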